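import Summits.BirchSwinnertonDyer.Rank1Residual.ManinAdditive.ShimuraIndexAtkinLehnerConj
import HarnessLib

/-!
# THEOREM AL, part 2 — THEOREM AL₍p₎ (`p³ ∤ N`), the Euler form, E-es-71♮ `ShimuraCharacterSupportLaw` PROVED,
# E-es-71 ⟸ the Atkin–Lehner eigenvector property of newforms (cell `bsd-f2-manin`, es g20 §33.11–33.12, T-es-26 part B)

For a weight-2 cusp form `f` on `Γ₀(N)` (NO newform hypothesis unless stated):
* THEOREM AL₍p₎ `noTorsion_of_atkinLehner_eq_neg`: `Q = p^k ∥ N`, `k ≤ 2`, `p` odd, `w_Q f = −f` ⟹ `2(p−1)Λ₀(f) ⊆ Λ₁(f)`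
  (Fermat `d_ν^{p−1} ≡ 1 (mod p)`; for `k = 2` the parabolic `ρ_t` fixing the cusp `1/p` corrects `d` to `1 (mod N)`);
* Euler form `totientMul_cuspSymbol_mem_of_atkinLehner_eq_neg`: `Q ∥ N`, `w_Q f = −f` ⟹ `2φ(Q)·Λ₀(f) ⊆ Λ₁(f)`, hence no
  `p`-torsion in `Λ₀/Λ₁` for odd `p ∤ φ(Q)`;
* **E-es-71♮ IS A THEOREM** `shimuraCharacterSupportLaw_holds : ShimuraCharacterSupportLaw`
  (`p ∣ [Λ₀:Λ₁]`, `p` odd, `λ_q = −1` ⟹ (`q ≠ p ∧ p ∣ q−1`) ∨ (`q = p ∧ p³ ∣ N`));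
* **E-es-71 ⟸ E-es-78** `atkinLehnerShimuraSignLaw_of_eigenvectorLaw`: the full sign law from the Atkin–Lehner eigenvector
  property of newforms alone (Atkin–Lehner 1970 Thm. 3; tree fact `IsNewform0.exists_atkinLehnerInvolutionAt_eq_smul`, all
  levels) — existence of the `−1` by THEOREM F via `w_N = ∏ w_{Q_q}` (`frickeInvolution_eq_prod_smul_of_forall`), uniqueness
  by E-es-77 (part 1);
* consequences for stub 5 of `kato_shift_three` (crux C3, stmt-BirchSwinnertonDyer-22968): on `9 ∥ N` the μ₃-chain needs the
  SIGN LAW E-es-72 only — `plusIndexPrimeToThreeOfMuThreeNoRationalThreeTorsion_of_signLaw hS h27` (TURNKEY-es-12).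
bears_on: stmt-BirchSwinnertonDyer-22968.  PARTITION 0.  BSD is not proved by this; Manin's conjecture is not proved by this.
-/

noncomputable section

open scoped Classical MatrixGroups ModularForm ComplexConjugate

open CongruenceSubgroup Complex WeierstrassCurve UpperHalfPlane Literature.NumberTheory.EllipticCurves
  Literature.NumberTheory.EllipticCurves.ModularForms

namespace Summit.BirchSwinnertonDyer.Rank1Residual.ManinAdditive.KatoCurve

open Summit.BirchSwinnertonDyer.Rank1Residual.ManinAdditive.CuspidalKummer
  Summit.BirchSwinnertonDyer.Rank1Residual.ManinAdditive.CuspidalKummerThree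

section ALLattice

variable {N : ℕ} [NeZero N] {Q : ℕ} [NeZero Q]

omit [NeZero N] in
/-- The parabolic `ρ_t = (1 + pRt, −Rt; p²Rt, 1 − pRt) ∈ Γ₀(p²R)` fixes the cusp `1/p`, so `{∞, ρ_t ∞}_f = 0`
(Manin relation `modularSymbol_gamma0_smul`). -/
theorem exists_parabolic [NeZero N] {p R : ℕ} (hp : p ≠ 0) (hN : (N : ℤ) = (p : ℤ) ^ 2 * R) (t : ℤ)
    (f : CuspForm (Gamma0 N) 2) :
    ∃ ρ : Gamma0 N, cuspSymbol f ρ = 0 ∧ (((ρ : SL(2, ℤ)) 0 1 : ℤ) = -((R : ℤ) * t)) ∧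
      (((ρ : SL(2, ℤ)) 1 1 : ℤ) = 1 - (p : ℤ) * R * t) := by
  let M : SL(2, ℤ) := ⟨!![1 + (p : ℤ) * R * t, -((R : ℤ) * t); (p : ℤ) ^ 2 * R * t, 1 - (p : ℤ) * R * t], by
    rw [Matrix.det_fin_two_of]; ring⟩
  have hM : M ∈ Gamma0 N := by
    rw [Gamma0_mem]
    simp only [M, Matrix.of_apply, Matrix.cons_val', Matrix.cons_val_zero, Matrix.cons_val_one,
      Matrix.cons_val_fin_one]
    have hN0 : ((N : ℤ) : ZMod N) = 0 := by simp
    rw [hN] at hN0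
    push_cast at hN0 ⊢
    linear_combination (t : ZMod N) * hN0
  refine ⟨⟨M, hM⟩, ?_, ?_, ?_⟩
  · have hp' : (p : ℚ) ≠ 0 := by exact_mod_cast hp
    have hden : ((p : ℚ) ^ 2 * R * t) * (1 / p) + (1 - p * R * t) = 1 := by field_simp; ring
    have hr : ((((⟨M, hM⟩ : Gamma0 N) : SL(2, ℤ)) 1 0 : ℤ) : ℚ) * (1 / p) +
        ((((⟨M, hM⟩ : Gamma0 N) : SL(2, ℤ)) 1 1 : ℤ) : ℚ) ≠ 0 := by
      simp only [M, Matrix.of_apply, Matrix.cons_val', Matrix.cons_val_zero, Matrix.cons_val_one,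
        Matrix.cons_val_fin_one]
      push_cast
      rw [hden]; exact one_ne_zero
    have key := modularSymbol_gamma0_smul_holds f ⟨M, hM⟩ (1 / p) hr
    have harg : ((((⟨M, hM⟩ : Gamma0 N) : SL(2, ℤ)) 0 0 : ℤ) : ℚ) * (1 / p) +
        ((((⟨M, hM⟩ : Gamma0 N) : SL(2, ℤ)) 0 1 : ℤ) : ℚ) = 1 / p := by
      simp only [M, Matrix.of_apply, Matrix.cons_val', Matrix.cons_val_zero, Matrix.cons_val_one,
        Matrix.cons_val_fin_one]
      push_cast
      field_simp; ring
    have hden' : ((((⟨M, hM⟩ : Gamma0 N) : SL(2, ℤ)) 1 0 : ℤ) : ℚ) * (1 / p) +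
        ((((⟨M, hM⟩ : Gamma0 N) : SL(2, ℤ)) 1 1 : ℤ) : ℚ) = 1 := by
      simp only [M, Matrix.of_apply, Matrix.cons_val', Matrix.cons_val_zero, Matrix.cons_val_one,
        Matrix.cons_val_fin_one]
      push_cast
      exact hden
    rw [harg, hden', div_one] at key
    linear_combination -key
  · simp only [M, Matrix.of_apply, Matrix.cons_val', Matrix.cons_val_zero, Matrix.cons_val_one,
      Matrix.cons_val_fin_one]
  · simp only [M, Matrix.of_apply, Matrix.cons_val', Matrix.cons_val_one, Matrix.cons_val_fin_one]

/-- STEP 2 (**per-period law**): `w_Q f = −f` with `Q = p^k ∥ N`, `k ≤ 2`, `p` prime ⟹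
`2(p−1)·{∞, γ∞}_f ∈ Λ₁(f)` for every `γ ∈ Γ₀(N)` (`ν^{p−1}`, times a parabolic at the cusp `1/p` when `k = 2`,
lies in `Γ₁(N)` up to the `d ≡ 1` criterion). -/
theorem natMul_cuspSymbol_mem_of_atkinLehner_eq_neg {p k : ℕ} (hp : p.Prime) (hk : k = 1 ∨ k = 2)
    (hQ : Q = p ^ k) (hQN : Q ∣ N) (hcop : Nat.Coprime Q (N / Q)) (f : CuspForm (Gamma0 N) 2)
    (hε : atkinLehnerInvolution N 2 Q f = (-1 : ℂ) • f) (γ : Gamma0 N) :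
    ((2 * (p - 1) : ℕ) : ℂ) * cuspSymbol f γ ∈ periodLatticeGamma1 f := by
  obtain ⟨ν, hν, hν1, -⟩ := exists_eta_of_atkinLehner_eq_neg hQN hcop f hε γ
  set R : ℕ := N / Q with hR
  have hNQR : N = Q * R := (Nat.mul_div_cancel' hQN).symm
  haveI := Fact.mk hp
  have hk1 : k ≠ 0 := by rcases hk with rfl | rfl <;> norm_num
  have hpQ : p ∣ Q := by rw [hQ]; exact dvd_pow_self p hk1
  have hpN : p ∣ N := hpQ.trans hQN
  have hcopR : IsCoprime (p : ℤ) (R : ℤ) :=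
    Nat.isCoprime_iff_coprime.mpr (Nat.Coprime.coprime_dvd_left hpQ hcop)
  set d : ℤ := ((ν : SL(2, ℤ)) 1 1 : ℤ) with hd
  have hu : IsUnit ((d : ZMod N)) := isUnit_apply_one_one ν
  have hdp : (d : ZMod p) ≠ 0 := by
    intro h0
    have h1 := hu.map (ZMod.castHom hpN (ZMod p))
    rw [map_intCast, h0] at h1
    exact not_isUnit_zero h1
  have hferm : (d : ZMod p) ^ (p - 1) = 1 := ZMod.pow_card_sub_one_eq_one hdp
  have hp1 : (p : ℤ) ∣ d ^ (p - 1) - 1 := by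
    rw [← ZMod.intCast_zmod_eq_zero_iff_dvd]; push_cast; rw [hferm]; ring
  have hR1 : (R : ℤ) ∣ d ^ (p - 1) - 1 := by
    rw [← ZMod.intCast_zmod_eq_zero_iff_dvd]; push_cast; rw [hν1]; ring
  have hνsym : ((p - 1 : ℕ) : ℂ) * cuspSymbol f ν = ((2 * (p - 1) : ℕ) : ℂ) * cuspSymbol f γ := by
    rw [hν]; push_cast; ring
  rcases hk with rfl | rfl
  · -- `k = 1`: `d_ν^{p−1} ≡ 1 (mod N)`
    have hN1 : (N : ℤ) ∣ d ^ (p - 1) - 1 := by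
      have : (N : ℤ) = p * R := by rw [hNQR, hQ]; push_cast; ring
      rw [this]; exact IsCoprime.mul_dvd hcopR hp1 hR1
    have h1 : (d : ZMod N) ^ (p - 1) = 1 := by
      have := (ZMod.intCast_zmod_eq_zero_iff_dvd _ N).mpr hN1
      push_cast at this
      exact sub_eq_zero.mp this
    rw [← hνsym]
    exact natCast_mul_cuspSymbol_mem_periodLatticeGamma1_of_pow_apply f ν (p - 1) (Or.inl h1)
  · -- `k = 2`: `d_ν^{p−1} ≡ 1 (mod N/p)`; correct by the parabolic at `1/p`
    obtain ⟨t, ht⟩ := IsCoprime.mul_dvd hcopR hp1 hR1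
    have hN' : (N : ℤ) = (p : ℤ) ^ 2 * R := by rw [hNQR, hQ]; push_cast; ring
    obtain ⟨ρ, hρ0, hρ01, hρ11⟩ := exists_parabolic hp.ne_zero hN' t f
    have hA10 : (((((ν ^ (p - 1) : Gamma0 N)) : SL(2, ℤ)) 1 0 : ℤ) : ZMod N) = 0 :=
      Gamma0_mem.mp (ν ^ (p - 1)).2
    have hA11 : (((((ν ^ (p - 1) : Gamma0 N)) : SL(2, ℤ)) 1 1 : ℤ) : ZMod N) =
        1 + (p : ZMod N) * R * t := by
      rw [apply_one_one_pow_eq, ← Int.cast_pow,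
        show d ^ (p - 1) = 1 + (p : ℤ) * R * t by linear_combination ht]
      push_cast; ring
    have hNz : ((p : ZMod N)) ^ 2 * R = 0 := by
      have h0 : ((N : ℤ) : ZMod N) = 0 := by simp
      rw [hN'] at h0; push_cast at h0; exact h0
    have hδ : (((((ν ^ (p - 1) * ρ : Gamma0 N)) : SL(2, ℤ)) 1 1 : ℤ) : ZMod N) = 1 := by
      have e : ((((ν ^ (p - 1) * ρ : Gamma0 N)) : SL(2, ℤ)) 1 1 : ℤ) =
          ((ν ^ (p - 1) : Gamma0 N) : SL(2, ℤ)) 1 0 * (ρ : SL(2, ℤ)) 0 1 +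
            ((ν ^ (p - 1) : Gamma0 N) : SL(2, ℤ)) 1 1 * (ρ : SL(2, ℤ)) 1 1 := by
        simp only [Subgroup.coe_mul, Matrix.SpecialLinearGroup.coe_mul, Matrix.mul_apply,
          Fin.sum_univ_two]
      rw [e, hρ01, hρ11]
      simp only [Int.cast_add, Int.cast_mul, Int.cast_neg, Int.cast_sub, Int.cast_one,
        Int.cast_natCast, hA10, hA11]
      linear_combination (-((R : ZMod N) * t ^ 2)) * hNz
    have hmem := cuspSymbol_mem_periodLatticeGamma1_of_apply_eq_one f _ hδ
    rw [cuspSymbol_mul_holds f, hρ0, add_zero, cuspSymbol_pow_eq_natCast_mul, hνsym] at hmem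
    exact hmem

/-- STEP 3 (**THEOREM AL₍p₎**, PROVED): for a weight-2 cusp form `f` on `Γ₀(N)` with `w_Q f = −f`,
`Q = p^k ∥ N`, `k ≤ 2`, `p` an odd prime: `2(p−1) Λ₀(f) ⊆ Λ₁(f)`, hence `Λ₀(f)/Λ₁(f)` has no `p`-torsion. -/
theorem noTorsion_of_atkinLehner_eq_neg {p k : ℕ} (hp : p.Prime) (hp2 : p ≠ 2) (hk : k = 1 ∨ k = 2)
    (hQ : Q = p ^ k) (hQN : Q ∣ N) (hcop : Nat.Coprime Q (N / Q)) (f : CuspForm (Gamma0 N) 2)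
    (hε : atkinLehnerInvolution N 2 Q f = (-1 : ℂ) • f) :
    (∀ x ∈ periodLattice f, ((2 * (p - 1) : ℕ) : ℂ) * x ∈ periodLatticeGamma1 f) ∧
      ∀ x ∈ periodLattice f, (p : ℂ) * x ∈ periodLatticeGamma1 f → x ∈ periodLatticeGamma1 f :=
  noTorsion_of_natMul_cuspSymbol_mem
    (Nat.Coprime.mul_right ((Nat.coprime_primes hp Nat.prime_two).mpr hp2)
      ((Nat.coprime_self_sub_right hp.one_le).mpr (Nat.coprime_one_right p)))
    f (natMul_cuspSymbol_mem_of_atkinLehner_eq_neg hp hk hQ hQN hcop f hε)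

/-- **EULER VERSION** (any exact divisor `Q ∥ N` with `w_Q f = −f`): `2φ(Q)·{∞, γ∞}_f ∈ Λ₁(f)` for every
`γ ∈ Γ₀(N)` (`d_ν^{φ(Q)} ≡ 1 (mod Q)` by Euler and `≡ 1 (mod N/Q)`). -/
theorem totientMul_cuspSymbol_mem_of_atkinLehner_eq_neg (hQN : Q ∣ N) (hcop : Nat.Coprime Q (N / Q))
    (f : CuspForm (Gamma0 N) 2) (hε : atkinLehnerInvolution N 2 Q f = (-1 : ℂ) • f) (γ : Gamma0 N) :
    ((2 * Q.totient : ℕ) : ℂ) * cuspSymbol f γ ∈ periodLatticeGamma1 f := by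
  obtain ⟨ν, hν, hν1, -⟩ := exists_eta_of_atkinLehner_eq_neg hQN hcop f hε γ
  set R : ℕ := N / Q with hR
  have hNQR : (N : ℤ) = Q * R := by exact_mod_cast (Nat.mul_div_cancel' hQN).symm
  set d : ℤ := ((ν : SL(2, ℤ)) 1 1 : ℤ) with hd
  have hu : IsUnit ((d : ZMod N)) := isUnit_apply_one_one ν
  have huQ : IsUnit ((d : ZMod Q)) := by
    have h1 := hu.map (ZMod.castHom hQN (ZMod Q))
    rwa [map_intCast] at h1
  have hEuler : (d : ZMod Q) ^ Q.totient = 1 := by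
    obtain ⟨u, hu'⟩ := huQ
    rw [← hu', ← Units.val_pow_eq_pow_val, ZMod.pow_totient, Units.val_one]
  have hQ1 : (Q : ℤ) ∣ d ^ Q.totient - 1 := by
    rw [← ZMod.intCast_zmod_eq_zero_iff_dvd]; push_cast; rw [hEuler]; ring
  have hR1 : (R : ℤ) ∣ d ^ Q.totient - 1 := by
    rw [← ZMod.intCast_zmod_eq_zero_iff_dvd]; push_cast; rw [hν1]; ring
  have hN1 : (N : ℤ) ∣ d ^ Q.totient - 1 := by
    rw [hNQR]; exact IsCoprime.mul_dvd (Nat.isCoprime_iff_coprime.mpr hcop) hQ1 hR1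
  have h1 : (d : ZMod N) ^ Q.totient = 1 := by
    have := (ZMod.intCast_zmod_eq_zero_iff_dvd _ N).mpr hN1
    push_cast at this
    exact sub_eq_zero.mp this
  have hmem := natCast_mul_cuspSymbol_mem_periodLatticeGamma1_of_pow_apply f ν Q.totient (Or.inl h1)
  rw [hν] at hmem
  convert hmem using 1
  push_cast; ring

/-- **THEOREM AL (support, PROVED)**: `w_Q f = −f`, `Q ∥ N`, `p` an odd prime with `p ∤ φ(Q)` ⟹ `2φ(Q) Λ₀(f) ⊆ Λ₁(f)`
and `Λ₀(f)/Λ₁(f)` has no `p`-torsion. -/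
theorem noTorsion_of_atkinLehner_eq_neg_of_not_dvd_totient {p : ℕ} (hp : p.Prime) (hp2 : p ≠ 2)
    (hpφ : ¬ p ∣ Q.totient) (hQN : Q ∣ N) (hcop : Nat.Coprime Q (N / Q)) (f : CuspForm (Gamma0 N) 2)
    (hε : atkinLehnerInvolution N 2 Q f = (-1 : ℂ) • f) :
    (∀ x ∈ periodLattice f, ((2 * Q.totient : ℕ) : ℂ) * x ∈ periodLatticeGamma1 f) ∧
      ∀ x ∈ periodLattice f, (p : ℂ) * x ∈ periodLatticeGamma1 f → x ∈ periodLatticeGamma1 f :=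
  noTorsion_of_natMul_cuspSymbol_mem
    (Nat.Coprime.mul_right ((Nat.coprime_primes hp Nat.prime_two).mpr hp2)
      ((Nat.Prime.coprime_iff_not_dvd hp).mpr hpφ))
    f (totientMul_cuspSymbol_mem_of_atkinLehner_eq_neg hQN hcop f hε)

end ALLattice

section ALAtPrime

variable {N : ℕ} [NeZero N]

/-- **THEOREM AL₍p₎** (PROVED): `p` an odd prime, `p ∣ N`, `p³ ∤ N`, and Atkin–Lehner eigenvalue
`λ_{Q_p}(f) = −1` ⟹ `2(p−1) Λ₀(f) ⊆ Λ₁(f)` and `Λ₀(f)/Λ₁(f)` has no `p`-torsion.  No newform hypothesis. -/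
theorem noTorsion_of_atkinLehnerEigenvalueAt_eq_neg_one (f : CuspForm (Gamma0 N) 2) {p : ℕ}
    (hp : p.Prime) (hp2 : p ≠ 2) (hpN : p ∣ N) (hp3 : ¬ p ^ 3 ∣ N)
    (hε : atkinLehnerEigenvalueAt f p = -1) :
    (∀ x ∈ periodLattice f, ((2 * (p - 1) : ℕ) : ℂ) * x ∈ periodLatticeGamma1 f) ∧
      ∀ x ∈ periodLattice f, (p : ℂ) * x ∈ periodLatticeGamma1 f → x ∈ periodLatticeGamma1 f := by
  set k : ℕ := N.factorization p with hk
  haveI : NeZero (p ^ k) := ⟨pow_ne_zero _ hp.ne_zero⟩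
  have hN0 : N ≠ 0 := NeZero.ne N
  have hQN : p ^ k ∣ N := Nat.ordProj_dvd N p
  have hcop : Nat.Coprime (p ^ k) (N / p ^ k) := Nat.Coprime.pow_left k (Nat.coprime_ordCompl hp hN0)
  have hk12 : k = 1 ∨ k = 2 := by
    have h1 : 0 < k := Nat.Prime.factorization_pos_of_dvd hp hN0 hpN
    have h2 : k < 3 := by
      by_contra h
      push Not at h
      exact hp3 ((pow_dvd_pow p h).trans hQN)
    omega
  have hinv : atkinLehnerInvolution N 2 (p ^ k) f = (-1 : ℂ) • f :=
    atkinLehnerInvolution_eq_neg_of_eigenvalueAt f rfl hε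
  exact noTorsion_of_atkinLehner_eq_neg hp hp2 hk12 rfl hQN hcop f hinv

/-- **THEOREM AL (support at `q ≠ p`, PROVED)**: `λ_{Q_q}(f) = −1` with `q ∣ N` prime, `p` an odd prime,
`q ≠ p`, `p ∤ q − 1` ⟹ `Λ₀(f)/Λ₁(f)` has no `p`-torsion (`p ∤ φ(q^{v_q N}) = q^{v−1}(q−1)`). -/
theorem shimuraIndexPrimeTo_of_atkinLehnerEigenvalueAt_eq_neg_one_of_ne (f : CuspForm (Gamma0 N) 2)
    {p q : ℕ} (hp : p.Prime) (hp2 : p ≠ 2) (hq : q.Prime) (hqN : q ∣ N) (hqp : q ≠ p)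
    (hdiv : ¬ p ∣ q - 1) (hε : atkinLehnerEigenvalueAt f q = -1) : ShimuraIndexPrimeTo p f := by
  have hN0 : N ≠ 0 := NeZero.ne N
  haveI : NeZero (q ^ N.factorization q) := ⟨pow_ne_zero _ hq.ne_zero⟩
  have hk : 0 < N.factorization q := Nat.Prime.factorization_pos_of_dvd hq hN0 hqN
  have hφ : ¬ p ∣ (q ^ N.factorization q).totient := by
    rw [Nat.totient_prime_pow hq hk]
    intro h
    rcases (Nat.Prime.dvd_mul hp).mp h with h1 | h1
    · exact hqp ((Nat.prime_dvd_prime_iff_eq hp hq).mp (hp.dvd_of_dvd_pow h1)).symm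
    · exact hdiv h1
  exact (noTorsion_of_atkinLehner_eq_neg_of_not_dvd_totient hp hp2 hφ (Nat.ordProj_dvd N q)
    (Nat.Coprime.pow_left _ (Nat.coprime_ordCompl hq hN0)) f
    (atkinLehnerInvolution_eq_neg_of_eigenvalueAt f rfl hε)).2

end ALAtPrime

section Consequences

/-- **COROLLARY (PROVED, unconditional)**: `λ_{Q_p}(f) = −1`, `p` odd, `p ∣ N`, `p³ ∤ N` ⟹ `ShimuraIndexPrimeTo p f`
— the law-free replacement of `shimuraIndexPrimeTo_of_signAtP`. -/
theorem shimuraIndexPrimeTo_of_atkinLehnerEigenvalueAt_eq_neg_one {N : ℕ} [NeZero N]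
    (f : CuspForm (Gamma0 N) 2) {p : ℕ} (hp : p.Prime) (hp2 : p ≠ 2) (hpN : p ∣ N) (hp3 : ¬ p ^ 3 ∣ N)
    (hε : atkinLehnerEigenvalueAt f p = -1) : ShimuraIndexPrimeTo p f :=
  (noTorsion_of_atkinLehnerEigenvalueAt_eq_neg_one f hp hp2 hpN hp3 hε).2

/-- … and hence `PlusIndexPrimeTo p f` (PROVED). -/
theorem plusIndexPrimeTo_of_atkinLehnerEigenvalueAt_eq_neg_one {N : ℕ} [NeZero N]
    (f : CuspForm (Gamma0 N) 2) {p : ℕ} (hp : p.Prime) (hp2 : p ≠ 2) (hpN : p ∣ N) (hp3 : ¬ p ^ 3 ∣ N)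
    (hε : atkinLehnerEigenvalueAt f p = -1) : PlusIndexPrimeTo p f :=
  plusIndexPrimeTo_of_shimuraIndexPrimeTo hp f
    (shimuraIndexPrimeTo_of_atkinLehnerEigenvalueAt_eq_neg_one f hp hp2 hpN hp3 hε)

/-- **E-es-67♯ on `9 ∥ N` from the SIGN LAW ALONE** (PROVED): THEOREM AL₍₃₎ replaces the law E-es-71♮ in
`plusIndexPrimeToThree_of_muThree_nine_not27`. -/
theorem plusIndexPrimeToThree_of_muThree_nine_not27' (hS : MuThreeOptimalSignAtNine)
    (W : WeierstrassCurve ℚ) [W.IsElliptic] [W.IsGloballyMinimal] {N : ℕ} [NeZero N]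
    (D : ModularParametrizationData W N) (hopt : ∀ z ∈ D.L.lattice, ∃ w ∈ periodLattice D.f, z = D.c * w)
    (h9 : 3 ^ 2 ∣ N) (h27 : ¬ 3 ^ 3 ∣ N) (hμ : HasShortMuThree W D.c)
    (hT : ∀ X₀ Y₀ : ℚ, ¬ IsShortThreeTorsion W D.c X₀ Y₀) : PlusIndexPrimeTo 3 D.f := by
  have hε := hS W D hopt h9 h27 hμ hT
  have h3N : 3 ∣ N := (dvd_pow_self 3 two_ne_zero).trans h9
  exact plusIndexPrimeTo_of_atkinLehnerEigenvalueAt_eq_neg_one D.f Nat.prime_three (by decide) h3N h27 hε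

/-- **E-es-67♯ = SIGN LAW (`9 ∥ N`) ∧ E-es-67♯₂₇** (PROVED; TURNKEY-es-12: binders E-es-72 and E-es-67♯₂₇ only;
with E-es-66 `h66`: `h66 W D hopt h9 (plusIndexPrimeToThree_of_muThree_nine_not27' hS W D hopt h9 h27 hμ hT)`). -/
theorem plusIndexPrimeToThreeOfMuThreeNoRationalThreeTorsion_of_signLaw (hS : MuThreeOptimalSignAtNine)
    (h27 : PlusIndexPrimeToThreeOfMuThreeAt27) : PlusIndexPrimeToThreeOfMuThreeNoRationalThreeTorsion := by
  intro W _ _ N _ D hopt h9 hμ hT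
  by_cases h : 3 ^ 3 ∣ N
  · exact h27 W D hopt h hμ hT
  · exact plusIndexPrimeToThree_of_muThree_nine_not27' hS W D hopt h9 h hμ hT

/-- **E-es-71♮ IS A THEOREM** (PROVED, no newform hypothesis used): closes the law `ShimuraCharacterSupportLaw`
of `ShimuraIndexSignLaws` — `p ∣ [Λ₀(f) : Λ₁(f)]`, `p` odd, `λ_q(f) = −1` ⟹ (`q ≠ p ∧ p ∣ q − 1`) ∨ (`q = p ∧ p³ ∣ N`). -/
theorem shimuraCharacterSupportLaw_holds : ShimuraCharacterSupportLaw := by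
  intro N _ f _ p hp hp2 hnot q hq hqN hε
  by_cases hqp : q = p
  · subst hqp
    refine Or.inr ⟨rfl, ?_⟩
    by_contra h3
    exact hnot (shimuraIndexPrimeTo_of_atkinLehnerEigenvalueAt_eq_neg_one f hp hp2 hqN h3 hε)
  · refine Or.inl ⟨hqp, ?_⟩
    by_contra hdiv
    exact hnot (shimuraIndexPrimeTo_of_atkinLehnerEigenvalueAt_eq_neg_one_of_ne f hp hp2 hq hqN hqp hdiv hε)

/-- `w_N f = (∏_{q ∣ N} λ_{Q_q}(f)) • f` for a simultaneous `w_{Q_q}`-eigenvector `f` (Knapp 1993, Lemma 9.24 /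
Thm. 9.27(c); the operator identity inside the tree's `frickeEigenvalue_eq_prod_atkinLehnerEigenvalueAt_of_forall`,
re-exported). -/
theorem frickeInvolution_eq_prod_smul_of_forall {N : ℕ} [NeZero N] {k : ℤ} {f : CuspForm (Gamma0 N) k}
    (h : ∀ p ∈ N.primeFactors, ∃ ε : ℂ, atkinLehnerInvolutionAt N k p f = ε • f) :
    frickeInvolution N k f = (∏ p ∈ N.primeFactors, atkinLehnerEigenvalueAt f p) • f := by
  have hlam : ∀ p ∈ N.primeFactors,
      atkinLehnerInvolutionAt N k p f = atkinLehnerEigenvalueAt f p • f :=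
    fun p hp ↦ atkinLehnerInvolutionAt_eq_atkinLehnerEigenvalueAt_smul (h p hp)
  obtain ⟨m, a, b, c, d, hm, hdet, hslash⟩ :=
    exists_slash_eq_prod_smul N k hlam N.primeFactors subset_rfl
  have hprod : ∏ p ∈ N.primeFactors, p ^ N.factorization p = N :=
    Nat.prod_factorization_pow_eq_self (NeZero.ne N)
  rw [hprod] at hm hdet
  have hrN : (((N : ℝ) ^ (1 - (k : ℝ) / 2) : ℝ) : ℂ) ≠ 0 :=
    Complex.ofReal_ne_zero.mpr (Real.rpow_pos_of_pos (by exact_mod_cast NeZero.pos N) _).ne'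
  have hcoe : (⇑(frickeInvolution N k f) : ℍ → ℂ) =
      (∏ p ∈ N.primeFactors, atkinLehnerEigenvalueAt f p) • ⇑f := by
    rw [frickeInvolution_apply_eq_slash_holds N k f, ← slash_eq_slash_frickeGL_of_entries N k hm hdet f,
      hslash, smul_smul, Finset.prod_mul_distrib, Finset.prod_inv_distrib, prod_rpow_ordProj_eq N k,
      ← mul_assoc, mul_inv_cancel₀ hrN, one_mul]
  apply DFunLike.coe_injective
  rw [hcoe, CuspForm.IsGLPos.coe_smul]

/-- **E-es-71 AT LEVEL `N` FROM KNAPP 9.27(b)** (PROVED modulo the named Literature fact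
`IsNewform0.exists_atkinLehnerInvolutionAt_eq_smul` = "a newform is a `±1`-eigenvector of every `w_{Q_q}`"):
a newform with `p ∣ [Λ₀(f) : Λ₁(f)]`, `p` odd, has EXACTLY ONE prime `q ∣ N` with `λ_q(f) = −1` — existence is
THEOREM F (all `λ_q = +1` ⟹ `w_N f = f` ⟹ `2Λ₀ ⊆ Λ₁`), uniqueness is the two-primes theorem (`4Λ₀ ⊆ Λ₁`). -/
theorem existsUnique_atkinLehnerEigenvalueAt_eq_neg_one {N : ℕ} [NeZero N]
    (hAL : IsNewform0.exists_atkinLehnerInvolutionAt_eq_smul (N := N) (k := 2))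
    (f : CuspForm (Gamma0 N) 2) (hf : IsNewform0 f) {p : ℕ} (hp : p.Prime) (hp2 : p ≠ 2)
    (hnot : ¬ ShimuraIndexPrimeTo p f) : ∃! q : ℕ, q.Prime ∧ q ∣ N ∧ atkinLehnerEigenvalueAt f q = -1 := by
  have hex : ∃ q, q.Prime ∧ q ∣ N ∧ atkinLehnerEigenvalueAt f q = -1 := by
    by_contra hne
    push Not at hne
    apply hnot
    have hε : ∀ q ∈ N.primeFactors, ∃ ε : ℂ, atkinLehnerInvolutionAt N 2 q f = ε • f := by
      intro q hq
      have hq' := Nat.mem_primeFactors.mp hq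
      obtain ⟨ε, -, hεf⟩ := hAL hf hq'.1 hq'.2.1
      exact ⟨ε, hεf⟩
    have h1 : ∀ q ∈ N.primeFactors, atkinLehnerEigenvalueAt f q = 1 := by
      intro q hq
      have hq' := Nat.mem_primeFactors.mp hq
      obtain ⟨ε, hε, hεf⟩ := hAL hf hq'.1 hq'.2.1
      have hεq := atkinLehnerEigenvalueAt_eq_of_eq_smul hf.ne_zero hεf
      rcases hε with rfl | rfl
      · exact hεq
      · exact absurd hεq (hne q hq'.1 hq'.2.1)
    have hw : frickeInvolution N 2 f = (1 : ℂ) • f := by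
      rw [frickeInvolution_eq_prod_smul_of_forall hε, Finset.prod_eq_one h1]
    exact shimuraIndexPrimeTo_of_frickePlus f (isFrickeEigen_of_frickeInvolution_eq_smul N hw) hp hp2
  obtain ⟨q, hq, hqN, hqε⟩ := hex
  refine ⟨q, ⟨hq, hqN, hqε⟩, fun q' hq' => ?_⟩
  by_contra hne
  exact hnot (shimuraIndexPrimeTo_of_two_atkinLehnerEigenvalueAt_eq_neg_one f hp hp2 hq'.1 hq hne
    hq'.2.2 hqε)

/-- **E-es-78 `AtkinLehnerNewformEigenvectorLaw`** (weight 2, all levels): a newform on `Γ₀(N)` is a `±1`-eigenvector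
of every `w_{Q_q}`, `q ∣ N` — Atkin–Lehner 1970, Thm. 3 / Knapp 1993, Thm. 9.27(b). In the tree this is the named
Literature fact `IsNewform0.exists_atkinLehnerInvolutionAt_eq_smul` (one level at a time; a THEOREM at `q ∥ N`,
`IsNewform0.exists_atkinLehnerInvolutionAt_eq_smul_of_not_dvd`); typed here as the all-level conjunction so that
E-es-71 is discharged against ONE named input (a theorem in print, not a conjecture of ours).
TYPER FRAMING (cell bsd-f2-manin, lens es; source HOME/es/T-es-26B-ShimuraIndexAtkinLehnerProofs.lean sha16 6052fe4bbd4bff27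
VERBATIM, T-es-26 v2): this item is a THEOREM IN PRINT ([AtkinLehner1970, Thm. 3]; [Knapp1993, Thm. 9.27(b)]) whose tree
form is the Literature named fact `IsNewform0.exists_atkinLehnerInvolutionAt_eq_smul` (level by level; discharged in the tree at
`q ∥ N` by `IsNewform0.exists_atkinLehnerInvolutionAt_eq_smul_of_not_dvd`), NOT a cell law — it carries the `conjecture` tag
only as the registered INPUT NODE of the edge `atkinLehnerShimuraSignLaw_of_eigenvectorLaw` (E-es-71 ⟸ E-es-78); its discharge
is a literature-prover target (`theorem atkinLehnerNewformEigenvectorLaw_holds` := the all-level Literature `_holds` once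
landed), no BC5 census applies.  REF1 R-es-40 (statement audit: «E-es-78 is verbatim the tree fact ∀ N, weight 2») PENDING at
filing.  Beyond-print theorem: no (in print).
[cite: AtkinLehner1970, Thm. 3] -/
@[conjecture]
def AtkinLehnerNewformEigenvectorLaw : Prop :=
  ∀ (N : ℕ) [NeZero N], IsNewform0.exists_atkinLehnerInvolutionAt_eq_smul (N := N) (k := 2)

/-- **E-es-71 ⟸ E-es-78** (PROVED): `AtkinLehnerShimuraSignLaw` follows from the Atkin–Lehner eigenvector property of
newforms alone — existence of the sign `−1` by THEOREM F, uniqueness by E-es-77. -/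
theorem atkinLehnerShimuraSignLaw_of_eigenvectorLaw (h : AtkinLehnerNewformEigenvectorLaw) :
    AtkinLehnerShimuraSignLaw :=
  fun N _ f hf _ hp hp2 hnot ↦ existsUnique_atkinLehnerEigenvalueAt_eq_neg_one (h N) f hf hp hp2 hnot

end Consequences

end Summit.BirchSwinnertonDyer.Rank1Residual.ManinAdditive.KatoCurve

end
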